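import Summits.QuantumFields.YangMills.Theorems.BalabanUVNodesN15KingModelFullPropagatorRateProfile
import Summits.QuantumFields.YangMills.Theorems.BalabanUVNodesN15KingModelFullPropagatorPowerLaw

/-!
# BalabanUVNodes ∕ N15 — THE KING-MODEL RUNG, CURVED EDITION (PART S-b): THE TWO-SPACING η-RATE POWER LAW OF THE FULL `A = 0`
# FLUCTUATION PROPAGATOR — `|G^{η′}_{K+n}(x′, y′) − G^η_K(x, y)| ≤ C·|x′ − y′|^{2−(d+1)}·(η∕|x′ − y′|)^{γ∕2}` for ALL pairs with
# `|x′ − y′| ≥ η` (unit coordinates), UNIFORMLY in `K`, `n`, the volume and the mass: King's (3.73) summed over (2.17), with the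
# scale-covariant rate factor «(lattice spacing ∕ distance)^γ» of `T4EtaRate.rateFactor`
# (Track A, DAG node N15 = NE2; FAN-OUT v1.1 §N15 s3 «KING-MODEL RUNG … + the one-line statement of what the curved case adds»)

HONEST FRAMING.  Count-neutral kernel bookkeeping (cell `pub-ymgap`, seat `pub-ymgap-dag-n15-e` g8; `--supports stmt-QuantumFields-20296
--as helper` = K3⁵ `SpineGivenEndpointR13SepCoP`, WORDS-141).  TEMPLATE LITERATURE, `A = 0`: C. King's scalar U(1)-Higgs MODEL on finite tori ([King1986]
§2.2 p. 653 (2.13)–(2.17), p. 654 (2.20), Prop. 3.9 (3.73) p. 665 «`|G^{η′}_{(j)}(x′, y′) − G^η_{(j)}(x, y)| ≤ CL^{−γk}(L^jη)^{2−d−γ}exp[−δ₀(L^jη)^{−1}|x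
− y|]`» — per slice the (3.63) majorant times `(η∕L^jη)^γ`; King's `d` = this file's `d + 1`), NOT Bałaban's covariant objects; the statement below
is the (2.17)-SUMMED SHAPE of (3.73) for King's (2.13) at `A = 0`, NOT a printed proposition; NE2⁺ is NOT PRINTED and not proved here; NOT a node
discharge; nothing continuum ∕ ℝ⁴ ∕ OS ∕ mass-gap ∕ Clay.  0 `sorry`, 0 `def`, standard axioms.

THE POINT.  Part S-a (`fullProp_rateProfile_unif`) proved, for ALL pairs of the fine run, `|G^{η′}_{K+n}(x′, y′) − G^η_K(x, y)| ≤
C·[θ^K·Σ_{i<K}(ΛL^{γ∕2})^i e^{−δr′L^i∕N′} + Σ_{i<n}Λ^{K+i} e^{−δr′L^{K+i}∕N′}]` (`θ = L^{−γ∕2}`, `r′` the fine distance, `N′ = L^nL^K`).  THIS FILE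
sums it in closed form on the pairs resolved by the coarse lattice, `r′ ≥ L^n` (`|x′ − y′| ≥ η`), writing `ρ = r′∕L^n ≥ 1`:
* §1 `rpow_mul_exp_neg_le` (`x^s e^{−x} ≤ 2e^{−x∕2}`, `0 ≤ s ≤ 1`), `theta_pow_mul_phi_pow` (`θ^K(L^{s})^i = (L^i∕L^K)^s`), ★ **`levelSum_rate_le`**
  — the PAIRED levels: `θ^K·Σ_{i<K}(L^pL^s)^i e^{−δρL^i∕L^K} ≤ 2δ^{−s}·(K_p(δ∕2L)∕L^p)·(L^K∕ρ)^p·ρ^{−s}` (the rate at scale `L^{K−i}` is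
  `(x_i∕δρ)^s`, `x_i = δρL^i∕L^K` the exponent, and `x^s e^{−x} ≤ 2e^{−x∕2}` hands it to part R-b's `levelSum_le_powerLaw` at rate `δ∕2`);
  ★ **`unpairedSum_le`** — the UNPAIRED fine levels: `Σ_{i<n}(L^p)^{K+i} e^{−δρL^i} ≤ (2(p+1)!∕δ^{p+1})·(L^K∕ρ)^p·ρ⁻¹` (`e^{−δt} ≤ (p+1)!∕(δt)^{p+1}`,
  `King1986.pow_mul_exp_neg_le`, and the geometric series `Σ L^{−i} ≤ 2`): below the coarse spacing the fine run's own singularity is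
  summable against the resolved distance and costs one extra power `ρ⁻¹ ≤ ρ^{−γ∕2}`;
* §2 ★★★ **`fullProp_ratePowerLaw_unif`** (`2 ≤ d`, `0 ≤ γ ≤ 1`): `∃ C > 0 ∀ K ≥ 1 ∀ n ≥ 1 ∀ cube 2L^e ∀ 0 < m² ≤ m₀² ∀ x′ y′` with
  `r′ = |x′ − y′|_{fine L^nL^K M} ≥ L^n`:  `|G(K+n, M, m²)(x′, y′) − G(K, M, m²)(x, y)| ≤ C·(L^nL^K∕r′)^{d−1}·(L^n∕r′)^{γ∕2}` — in unit coordinates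
  (`|x′ − y′| = r′∕(L^nL^K)`, `η = L^{−K}`, `η′ = L^{−n}η`) this is `C·|x′ − y′|^{2−(d+1)}·(η∕|x′ − y′|)^{γ∕2}`: the (3.63)-summed singularity of
  parts R times the SCALE-COVARIANT RATE FACTOR `(η∕|x′ − y′|)^{γ∕2}` — «(lattice spacing ∕ size)^γ, of order one at the finest scale and
  `θ^K` at the unit scale» (`T4EtaRate` §2, `rateFactor`; King's (3.73) factor `L^{−γk}(L^jη)^{−γ} = (η∕L^jη)^γ` at the slice scale `L^jη ≈ |x′−y′|`),
  UNIFORM in `K`, `n`, the volume and the mass.  This is the CORRECT all-pairs form of NE2's kernel-level η-rate for the full propagator: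
  part O-b is its unit-scale case (`|x′ − y′| ≥ D₀` unit blocks ⇒ factor `θ^K = η^{γ∕2}`), and part O-c's «no `K`-uniform rate on the
  diagonal» is the statement that the factor is `1` at `|x′ − y′| = η`.
WHAT THE CURVED CASE ADDS (one line): the same for Bałaban's pair `G_{k+n}(U′), G_k(U)` uniformly over `Reg335` — not printed as an η-difference
([B9] Thm 3.4: analyticity in `U`, η-uniformity only); the typed `T4EtaRate.EtaRateIneq342` carries exactly this `rateFactor` at the sites' scales.
HONEST SCOPE.  (i) `A = 0`, periodic b.c., odd `L ≥ 3`, `0 < m² ≤ m₀²`, cubes `2L^e`; (ii) lattice units of the respective levels; (iii) `K, n ≥ 1`,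
`d ≥ 2`; (iv) pairs with `r′ ≥ L^n` only (below the coarse spacing the difference is the fine run's own singularity, parts R-b∕S-a); (v) rate
exponent `γ∕2` (part M's); (vi) not Bałaban's `G_k(U)`; not a discharge.
Locators: [King1986] C. King, CMP **102** (1986) 649–677: (2.13)–(2.17) p. 653, (2.20) p. 654, Theorem 3.3 p. 655, (3.7) p. 656, Prop. 3.7
(3.63) p. 663, Prop. 3.8 (3.71) p. 664, Prop. 3.9 (3.73) p. 665, (4.42)–(4.43) p. 675; [B9] = [Balaban1985BackgroundPropagators] Thm 3.14
pp. 426–427 (template), (3.42) p. 397.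
-/

noncomputable section

namespace Summit.QuantumFields.YangMills.BalabanUVNodes.N15KingModelRung.Curved

open Real Finset Matrix
open Literature.MathematicalPhysics.QuantumFieldTheory.Balaban1983to89.B5Prop11Plancherel (Tor fine)
open Literature.MathematicalPhysics.QuantumFieldTheory.King1986 (aK aK_pos pow_mul_exp_neg_le)
open Literature.MathematicalPhysics.QuantumFieldTheory.King1986.Torus (constrainedProp tdistT tdistT_nonneg)

variable {d : ℕ} (L : ℕ) [NeZero L]

/-! ## §1 Summing the rate profile: paired levels and unpaired levels -/

/-- `x^s·e^{−x} ≤ 2·e^{−x∕2}` for `x ≥ 0`, `0 ≤ s ≤ 1` (`x^s ≤ 1 + x ≤ 2e^{x∕2}`). [folklore] -/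
theorem rpow_mul_exp_neg_le {x s : ℝ} (hx : 0 ≤ x) (hs0 : 0 ≤ s) (hs1 : s ≤ 1) :
    x ^ s * Real.exp (-x) ≤ 2 * Real.exp (-(x / 2)) := by
  have h1 : x ^ s ≤ 1 + x := by
    rcases le_or_gt x 1 with hx1 | hx1
    · exact (Real.rpow_le_one hx hx1 hs0).trans (by linarith)
    · calc x ^ s ≤ x ^ (1 : ℝ) := Real.rpow_le_rpow_of_exponent_le hx1.le hs1
        _ = x := Real.rpow_one x
        _ ≤ 1 + x := by linarith
  have h2 : 1 + x ≤ 2 * Real.exp (x / 2) := by linarith [Real.add_one_le_exp (x / 2)]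
  have h3 : Real.exp (-x) = Real.exp (-(x / 2)) * Real.exp (-(x / 2)) := by
    rw [← Real.exp_add]; congr 1; ring
  have h4 : Real.exp (x / 2) * Real.exp (-(x / 2)) = 1 := by
    rw [← Real.exp_add]; simp
  calc x ^ s * Real.exp (-x) ≤ (1 + x) * Real.exp (-x) := mul_le_mul_of_nonneg_right h1 (Real.exp_pos _).le
    _ ≤ 2 * Real.exp (x / 2) * Real.exp (-x) := mul_le_mul_of_nonneg_right h2 (Real.exp_pos _).le
    _ = 2 * Real.exp (-(x / 2)) * (Real.exp (x / 2) * Real.exp (-(x / 2))) := by rw [h3]; ring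
    _ = 2 * Real.exp (-(x / 2)) := by rw [h4, mul_one]

/-- The rate of a paired level at its own scale: `(L^{−s})^K·(L^{s})^i = (L^i∕L^K)^s` (`L > 0`). [cite: King1986, Prop. 3.9 (3.73) p.665 (the factor `L^{−γk}(L^jη)^{−γ}`)] -/
theorem theta_pow_mul_phi_pow {Lr : ℝ} (hL : 0 < Lr) (s : ℝ) (K i : ℕ) :
    (Lr ^ (-s)) ^ K * (Lr ^ s) ^ i = (Lr ^ i / Lr ^ K) ^ s := by
  have hK : (Lr ^ (-s)) ^ K = (Lr ^ K) ^ (-s) := by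
    rw [← Real.rpow_natCast (Lr ^ (-s)) K, ← Real.rpow_mul hL.le, mul_comm, Real.rpow_natCast_mul hL.le]
  have hi : (Lr ^ s) ^ i = (Lr ^ i) ^ s := by
    rw [← Real.rpow_natCast (Lr ^ s) i, ← Real.rpow_mul hL.le, mul_comm, Real.rpow_natCast_mul hL.le]
  rw [hK, hi, Real.div_rpow (pow_nonneg hL.le i) (pow_nonneg hL.le K), Real.rpow_neg (pow_nonneg hL.le K), div_eq_mul_inv, mul_comm]

/-- **The paired levels sum to the power law times the rate factor `ρ^{−s}`**: for `L ≥ 2`, `δ > 0`, `p ≥ 1`, `0 ≤ s ≤ 1`, `ρ ≥ 1` and any `K`,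
`(L^{−s})^K·Σ_{i<K}(L^p·L^s)^i·e^{−δρL^i∕L^K} ≤ 2δ^{−s}·(K_p(δ∕(2L))∕L^p)·(L^K∕ρ)^p·ρ^{−s}`, `K_p(δ) = 2(p+1)!∕δ^{p+1} + 2` — each level's rate
`(L^i∕L^K)^s = (x_i∕δρ)^s` with `x_i` its exponent; `x^s e^{−x} ≤ 2e^{−x∕2}`; then part R-b `levelSum_le_powerLaw` at rate `δ∕2`.
[cite: King1986, Prop. 3.7 (3.63) p.663, Prop. 3.9 (3.73) p.665] -/
theorem levelSum_rate_le {Lr δ s ρ : ℝ} (hL : 2 ≤ Lr) (hδ : 0 < δ) {p : ℕ} (hp : 1 ≤ p) (hs0 : 0 ≤ s) (hs1 : s ≤ 1)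
    (K : ℕ) (hρ : 1 ≤ ρ) :
    (Lr ^ (-s)) ^ K * ∑ i ∈ Finset.range K, (Lr ^ p * Lr ^ s) ^ i * Real.exp (-(δ * (ρ * Lr ^ i / Lr ^ K)))
      ≤ 2 * δ ^ (-s) * ((2 * (p + 1).factorial / (δ / 2 / Lr) ^ (p + 1) + 2) / Lr ^ p) * (Lr ^ K / ρ) ^ p * ρ ^ (-s) := by
  have hL0 : 0 < Lr := by linarith
  have hρ0 : 0 < ρ := by linarith
  have hδρ : 0 < δ * ρ := mul_pos hδ hρ0
  -- termwise: `θ^K (L^pL^s)^i e^{−x_i} ≤ (L^p)^i·(δρ)^{−s}·2e^{−x_i∕2}`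
  have hterm : ∀ i ∈ Finset.range K,
      (Lr ^ (-s)) ^ K * ((Lr ^ p * Lr ^ s) ^ i * Real.exp (-(δ * (ρ * Lr ^ i / Lr ^ K))))
        ≤ (δ * ρ) ^ (-s) * 2 * ((Lr ^ p) ^ i * Real.exp (-(δ / 2 * (ρ * Lr ^ i / Lr ^ K)))) := by
    intro i _
    set x : ℝ := δ * (ρ * Lr ^ i / Lr ^ K) with hxdef
    have hx0 : 0 ≤ x := by positivity
    have hrate : (Lr ^ (-s)) ^ K * (Lr ^ s) ^ i = (x / (δ * ρ)) ^ s := by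
      rw [theta_pow_mul_phi_pow hL0 s K i]
      congr 1
      rw [hxdef]
      field_simp
    have hsplit : (x / (δ * ρ)) ^ s = x ^ s * (δ * ρ) ^ (-s) := by
      rw [Real.div_rpow hx0 hδρ.le, Real.rpow_neg hδρ.le, div_eq_mul_inv]
    have hkey := rpow_mul_exp_neg_le hx0 hs0 hs1
    have hx2 : x / 2 = δ / 2 * (ρ * Lr ^ i / Lr ^ K) := by rw [hxdef]; ring
    calc (Lr ^ (-s)) ^ K * ((Lr ^ p * Lr ^ s) ^ i * Real.exp (-x))
        = (Lr ^ p) ^ i * ((Lr ^ (-s)) ^ K * (Lr ^ s) ^ i) * Real.exp (-x) := by rw [mul_pow]; ring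
      _ = (Lr ^ p) ^ i * (δ * ρ) ^ (-s) * (x ^ s * Real.exp (-x)) := by rw [hrate, hsplit]; ring
      _ ≤ (Lr ^ p) ^ i * (δ * ρ) ^ (-s) * (2 * Real.exp (-(x / 2))) :=
          mul_le_mul_of_nonneg_left hkey (by positivity)
      _ = (δ * ρ) ^ (-s) * 2 * ((Lr ^ p) ^ i * Real.exp (-(δ / 2 * (ρ * Lr ^ i / Lr ^ K)))) := by rw [hx2]; ring
  have hsum := levelSum_le_powerLaw hL (half_pos hδ) hp K hρ
  have hδρs : (δ * ρ) ^ (-s) = δ ^ (-s) * ρ ^ (-s) := Real.mul_rpow hδ.le hρ0.le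
  calc (Lr ^ (-s)) ^ K * ∑ i ∈ Finset.range K, (Lr ^ p * Lr ^ s) ^ i * Real.exp (-(δ * (ρ * Lr ^ i / Lr ^ K)))
      = ∑ i ∈ Finset.range K, (Lr ^ (-s)) ^ K * ((Lr ^ p * Lr ^ s) ^ i * Real.exp (-(δ * (ρ * Lr ^ i / Lr ^ K)))) :=
        Finset.mul_sum _ _ _
    _ ≤ ∑ i ∈ Finset.range K, (δ * ρ) ^ (-s) * 2 * ((Lr ^ p) ^ i * Real.exp (-(δ / 2 * (ρ * Lr ^ i / Lr ^ K)))) :=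
        Finset.sum_le_sum hterm
    _ = (δ * ρ) ^ (-s) * 2 * ∑ i ∈ Finset.range K, (Lr ^ p) ^ i * Real.exp (-(δ / 2 * (ρ * Lr ^ i / Lr ^ K))) :=
        (Finset.mul_sum _ _ _).symm
    _ ≤ (δ * ρ) ^ (-s) * 2 * ((2 * (p + 1).factorial / (δ / 2 / Lr) ^ (p + 1) + 2) / Lr ^ p * (Lr ^ K / ρ) ^ p) :=
        mul_le_mul_of_nonneg_left hsum (by positivity)
    _ = 2 * δ ^ (-s) * ((2 * (p + 1).factorial / (δ / 2 / Lr) ^ (p + 1) + 2) / Lr ^ p) * (Lr ^ K / ρ) ^ p * ρ ^ (-s) := by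
        rw [hδρs]; ring

/-- A decreasing geometric series with ratio `≤ 1∕2`: `Σ_{i<n} L^{−i} ≤ 2` for `L ≥ 2`. [folklore] -/
theorem sum_inv_pow_le_two {Lr : ℝ} (hL : 2 ≤ Lr) (n : ℕ) : ∑ i ∈ Finset.range n, (Lr⁻¹) ^ i ≤ 2 := by
  have hL0 : 0 < Lr := by linarith
  have hq0 : 0 ≤ Lr⁻¹ := inv_nonneg.mpr hL0.le
  have hq : Lr⁻¹ ≤ 1 / 2 := by rw [inv_eq_one_div]; exact one_div_le_one_div_of_le (by norm_num) hL
  have hq1 : Lr⁻¹ ≠ 1 := by intro h; linarith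
  rw [geom_sum_eq hq1]
  have hden : Lr⁻¹ - 1 < 0 := by linarith
  rw [div_le_iff_of_neg hden]
  have hpow : 0 ≤ (Lr⁻¹) ^ n := pow_nonneg hq0 n
  nlinarith

/-- **The unpaired fine levels sum against the resolved distance**: for `L ≥ 2`, `δ > 0`, `ρ ≥ 1` and any `p, K, n`,
`Σ_{i<n}(L^p)^{K+i}·e^{−δ·ρ·L^{K+i}∕L^K} ≤ (2(p+1)!∕δ^{p+1})·(L^K∕ρ)^p·ρ⁻¹` — `e^{−δt} ≤ (p+1)!∕(δ^{p+1}t^{p+1})` at `t = ρL^i ≥ 1`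
(`King1986.pow_mul_exp_neg_le`) leaves the geometric series `Σ_i L^{−i} ≤ 2`. [cite: King1986, Prop. 3.7 (3.63) p.663] -/
theorem unpairedSum_le {Lr δ ρ : ℝ} (hL : 2 ≤ Lr) (hδ : 0 < δ) (p K n : ℕ) (hρ : 1 ≤ ρ) :
    ∑ i ∈ Finset.range n, (Lr ^ p) ^ (K + i) * Real.exp (-(δ * (ρ * Lr ^ (K + i) / Lr ^ K)))
      ≤ 2 * (p + 1).factorial / δ ^ (p + 1) * (Lr ^ K / ρ) ^ p * ρ⁻¹ := by
  have hL0 : 0 < Lr := by linarith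
  have hρ0 : 0 < ρ := by linarith
  have hfac : (0 : ℝ) < (p + 1).factorial := by exact_mod_cast Nat.factorial_pos _
  set A : ℝ := (p + 1).factorial / δ ^ (p + 1) with hAdef
  have hA0 : 0 ≤ A := by positivity
  have hterm : ∀ i ∈ Finset.range n,
      (Lr ^ p) ^ (K + i) * Real.exp (-(δ * (ρ * Lr ^ (K + i) / Lr ^ K)))
        ≤ A * (Lr ^ K / ρ) ^ p * ρ⁻¹ * (Lr⁻¹) ^ i := by
    intro i _
    set t : ℝ := ρ * Lr ^ i with htdef
    have ht : 0 < t := by positivity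
    have he : ρ * Lr ^ (K + i) / Lr ^ K = t := by
      rw [htdef, pow_add]; field_simp
    -- `e^{−δt} ≤ (p+1)!∕(δ^{p+1}·t^{p+1})`
    have h1 := pow_mul_exp_neg_le hδ ht p
    have h2 : Real.exp (-(δ * t)) ≤ A / t ^ (p + 1) := by
      rw [le_div_iff₀ (pow_pos ht _), pow_succ]
      calc Real.exp (-(δ * t)) * (t ^ p * t) = t ^ p * Real.exp (-(δ * t)) * t := by ring
        _ ≤ (p + 1).factorial / (δ ^ (p + 1) * t) * t := mul_le_mul_of_nonneg_right h1 ht.le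
        _ = A := by rw [hAdef]; field_simp
    have hsplit : (Lr ^ p) ^ (K + i) = (Lr ^ K) ^ p * (Lr ^ i) ^ p := by
      rw [pow_add, ← pow_mul, ← pow_mul, mul_comm p K, mul_comm p i, pow_mul, pow_mul]
    have hid : (Lr ^ p) ^ (K + i) * (A / t ^ (p + 1)) = A * (Lr ^ K / ρ) ^ p * ρ⁻¹ * (Lr⁻¹) ^ i := by
      rw [hsplit, htdef, mul_pow, div_pow, inv_pow]
      field_simp
      ring
    rw [he]
    calc (Lr ^ p) ^ (K + i) * Real.exp (-(δ * t)) ≤ (Lr ^ p) ^ (K + i) * (A / t ^ (p + 1)) :=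
          mul_le_mul_of_nonneg_left h2 (by positivity)
      _ = A * (Lr ^ K / ρ) ^ p * ρ⁻¹ * (Lr⁻¹) ^ i := hid
  calc ∑ i ∈ Finset.range n, (Lr ^ p) ^ (K + i) * Real.exp (-(δ * (ρ * Lr ^ (K + i) / Lr ^ K)))
      ≤ ∑ i ∈ Finset.range n, A * (Lr ^ K / ρ) ^ p * ρ⁻¹ * (Lr⁻¹) ^ i := Finset.sum_le_sum hterm
    _ = A * (Lr ^ K / ρ) ^ p * ρ⁻¹ * ∑ i ∈ Finset.range n, (Lr⁻¹) ^ i := (Finset.mul_sum _ _ _).symm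
    _ ≤ A * (Lr ^ K / ρ) ^ p * ρ⁻¹ * 2 := mul_le_mul_of_nonneg_left (sum_inv_pow_le_two hL n) (by positivity)
    _ = 2 * (p + 1).factorial / δ ^ (p + 1) * (Lr ^ K / ρ) ^ p * ρ⁻¹ := by rw [hAdef]; ring

/-! ## §2 The two-spacing power law with the scale-covariant rate factor -/

/-- **THE TWO-SPACING η-RATE POWER LAW OF KING'S FULL `A = 0` FLUCTUATION PROPAGATOR, ALL RESOLVED PAIRS** (`d ≥ 2`, `0 ≤ γ ≤ 1`): for odd
`L ≥ 3`, `a > 0`, `m₀² ≥ 0` there is `C > 0` (a function of `d, L, a, m₀², γ`) such that for EVERY `K ≥ 1`, `n ≥ 1`, cube `M_μ = 2L^e`, mass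
`0 < m² ≤ m₀²` and ALL fine points `x′, y′` of the `(K+n)`-level run at fine distance `r′ = |x′ − y′|_{fine L^nL^K M} ≥ L^n` (i.e. `|x′ − y′| ≥ η`
in unit coordinates), with King's pairing `x = underPtN x′`, `y = underPtN y′`:
`|G^{η′}_{K+n}(x′, y′) − G^η_K(x, y)| ≤ C·(L^nL^K∕r′)^{d−1}·(L^n∕r′)^{γ∕2}` = `C·|x′ − y′|^{2−(d+1)}·(η∕|x′ − y′|)^{γ∕2}` — the
(3.63)-summed singularity times the scale-covariant RATE FACTOR `(η∕|x′ − y′|)^{γ∕2}` (King's (3.73) factor `(η∕L^jη)^γ` at the scale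
`L^jη ≈ |x′ − y′|`; `T4EtaRate.rateFactor`'s «(lattice spacing∕size)^γ»), UNIFORM in `K`, `n`, the volume and the mass.  Part O-b is the
unit-scale case; part O-c's «no uniform rate on the diagonal» is the factor `= 1` at `|x′ − y′| = η` (part S-a `fullProp_rateProfile_unif` +
§1).  The (2.17)-summed SHAPE of Prop. 3.9 for King's (2.13) at `A = 0`; nothing here is Bałaban's `G_k(U)`.
[cite: King1986, (2.13)–(2.17) p.653, (2.20) p.654, Prop. 3.7 (3.63) p.663, Prop. 3.8 (3.71) p.664, Prop. 3.9 (3.73) p.665, (4.42)–(4.43) p.675; Balaban1985BackgroundPropagators, Thm 3.14 pp.426–427] -/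
theorem fullProp_ratePowerLaw_unif (hd : 2 ≤ d) (hLodd : Odd L) (hL : 2 ≤ L) {a : ℝ} (ha : 0 < a) {m0sq : ℝ} (hm0 : 0 ≤ m0sq)
    {γ : ℝ} (hγ0 : 0 ≤ γ) (hγ1 : γ ≤ 1) :
    ∃ C : ℝ, 0 < C ∧ ∀ (K : ℕ), 1 ≤ K → ∀ (n : ℕ), 1 ≤ n →
      ∀ (e : ℕ) (M : Fin (d + 1) → ℕ) [∀ μ, NeZero (M μ)], (∀ μ, M μ = 2 * L ^ e) →
      ∀ (msq : ℝ), 0 < msq → msq ≤ m0sq →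
      ∀ x' y' : Tor (fine (L ^ n * L ^ K) M), ((L ^ n : ℕ) : ℝ) ≤ tdistT (fine (L ^ n * L ^ K) M) x' y' →
        |constrainedProp (L ^ n * L ^ K) M (aK a L (K + n)) (((L ^ n * L ^ K : ℕ) : ℝ) ^ 2) msq x' y'
            - constrainedProp (L ^ K) M (aK a L K) (((L ^ K : ℕ) : ℝ) ^ 2) msq
                (underPtN L K n M x') (underPtN L K n M y')|
          ≤ C * (((L ^ n * L ^ K : ℕ) : ℝ) / tdistT (fine (L ^ n * L ^ K) M) x' y') ^ (d - 1)
              * (((L ^ n : ℕ) : ℝ) / tdistT (fine (L ^ n * L ^ K) M) x' y') ^ (γ / 2) := by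
  have hLr : (2 : ℝ) ≤ L := by exact_mod_cast hL
  have hL0 : (0 : ℝ) < L := by linarith
  have hp : 1 ≤ d - 1 := by omega
  have hs0 : 0 ≤ γ / 2 := by linarith
  have hs1 : γ / 2 ≤ 1 := by linarith
  obtain ⟨C₀, δ, hC₀, hδ, H⟩ := fullProp_rateProfile_unif (d := d) L hLodd hL ha hm0 hγ0 hγ1
  -- the two summation constants
  set A₁ : ℝ := 2 * δ ^ (-(γ / 2)) * ((2 * ((d - 1) + 1).factorial / (δ / 2 / L) ^ ((d - 1) + 1) + 2) / (L : ℝ) ^ (d - 1))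
    with hA₁
  set A₂ : ℝ := 2 * ((d - 1) + 1).factorial / δ ^ ((d - 1) + 1) with hA₂
  have hA₁0 : 0 < A₁ := by
    have : 0 < δ ^ (-(γ / 2)) := Real.rpow_pos_of_pos hδ _
    positivity
  have hA₂0 : 0 < A₂ := by positivity
  refine ⟨C₀ * (A₁ + A₂), by positivity, ?_⟩
  intro K hK n hn e M _ hM msq hmsq hcap x' y' hres
  have h := H K hK n hn e M hM msq hmsq hcap x' y'
  set r' : ℝ := tdistT (fine (L ^ n * L ^ K) M) x' y' with hr'def
  set Ln : ℝ := ((L ^ n : ℕ) : ℝ) with hLndef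
  have hLn : Ln = (L : ℝ) ^ n := by rw [hLndef]; push_cast; ring
  have hLn0 : 0 < Ln := by rw [hLn]; positivity
  have hr'0 : 0 < r' := lt_of_lt_of_le hLn0 hres
  -- the resolved distance in coarse-spacing units `ρ = r′∕L^n ≥ 1`
  set ρ : ℝ := r' / Ln with hρdef
  have hρ : 1 ≤ ρ := by rw [hρdef, le_div_iff₀ hLn0, one_mul]; exact hres
  have hρ0 : 0 < ρ := by linarith
  have hNc : ((L ^ n * L ^ K : ℕ) : ℝ) = Ln * (L : ℝ) ^ K := by rw [hLndef]; push_cast; ring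
  -- the exponents of part S-a in the variable `ρ`: `r′·L^m∕N′ = ρ·L^m∕L^K`
  have hexp : ∀ m : ℕ, r' * (L : ℝ) ^ m / ((L ^ n * L ^ K : ℕ) : ℝ) = ρ * (L : ℝ) ^ m / (L : ℝ) ^ K := fun m => by
    rw [hNc, hρdef]
    field_simp
  have hΛφ : (L : ℝ) ^ (d + 1) / (L : ℝ) ^ 2 * (L : ℝ) ^ (γ / 2) = (L : ℝ) ^ (d - 1) * (L : ℝ) ^ (γ / 2) := by
    rw [Lam_eq_pow L hL (by omega)]
  have hPS : ((L : ℝ) ^ (-(γ / 2))) ^ K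
        * ∑ i ∈ Finset.range K, ((L : ℝ) ^ (d + 1) / (L : ℝ) ^ 2 * (L : ℝ) ^ (γ / 2)) ^ i
            * Real.exp (-(δ * (r' * (L : ℝ) ^ i / ((L ^ n * L ^ K : ℕ) : ℝ))))
      = ((L : ℝ) ^ (-(γ / 2))) ^ K
        * ∑ i ∈ Finset.range K, ((L : ℝ) ^ (d - 1) * (L : ℝ) ^ (γ / 2)) ^ i
            * Real.exp (-(δ * (ρ * (L : ℝ) ^ i / (L : ℝ) ^ K))) := by
    congr 1
    exact Finset.sum_congr rfl fun i _ => by rw [hΛφ, hexp]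
  have hUS : ∑ i ∈ Finset.range n, ((L : ℝ) ^ (d + 1) / (L : ℝ) ^ 2) ^ (K + i)
          * Real.exp (-(δ * (r' * (L : ℝ) ^ (K + i) / ((L ^ n * L ^ K : ℕ) : ℝ))))
      = ∑ i ∈ Finset.range n, ((L : ℝ) ^ (d - 1)) ^ (K + i) * Real.exp (-(δ * (ρ * (L : ℝ) ^ (K + i) / (L : ℝ) ^ K))) :=
    Finset.sum_congr rfl fun i _ => by rw [Lam_eq_pow L hL (by omega), hexp]
  rw [hPS, hUS] at h
  -- §1
  have h1 := levelSum_rate_le hLr hδ hp hs0 hs1 K hρ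
  have h2 := unpairedSum_le hLr hδ (d - 1) K n hρ
  -- `ρ⁻¹ ≤ ρ^{−γ∕2}` (`ρ ≥ 1`)
  have hρinv : ρ⁻¹ ≤ ρ ^ (-(γ / 2)) := by
    rw [← Real.rpow_neg_one]
    exact Real.rpow_le_rpow_of_exponent_le hρ (by linarith)
  have hPow0 : 0 ≤ ((L : ℝ) ^ K / ρ) ^ (d - 1) := by positivity
  have h2' : ∑ i ∈ Finset.range n, ((L : ℝ) ^ (d - 1)) ^ (K + i) * Real.exp (-(δ * (ρ * (L : ℝ) ^ (K + i) / (L : ℝ) ^ K)))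
      ≤ A₂ * ((L : ℝ) ^ K / ρ) ^ (d - 1) * ρ ^ (-(γ / 2)) :=
    h2.trans (mul_le_mul_of_nonneg_left hρinv (by positivity))
  -- the two factors of the display in the variable `ρ`
  have hF1 : ((L ^ n * L ^ K : ℕ) : ℝ) / r' = (L : ℝ) ^ K / ρ := by
    rw [hNc, hρdef]
    field_simp
  have hF2 : Ln / r' = ρ⁻¹ := by rw [hρdef, inv_div]
  have hF3 : (ρ⁻¹) ^ (γ / 2) = ρ ^ (-(γ / 2)) := by
    rw [Real.inv_rpow hρ0.le, Real.rpow_neg hρ0.le]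
  rw [hF1, hF2, hF3]
  calc |constrainedProp (L ^ n * L ^ K) M (aK a L (K + n)) (((L ^ n * L ^ K : ℕ) : ℝ) ^ 2) msq x' y'
          - constrainedProp (L ^ K) M (aK a L K) (((L ^ K : ℕ) : ℝ) ^ 2) msq (underPtN L K n M x') (underPtN L K n M y')|
      ≤ C₀ * (((L : ℝ) ^ (-(γ / 2))) ^ K
            * ∑ i ∈ Finset.range K, ((L : ℝ) ^ (d - 1) * (L : ℝ) ^ (γ / 2)) ^ i
                * Real.exp (-(δ * (ρ * (L : ℝ) ^ i / (L : ℝ) ^ K)))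
          + ∑ i ∈ Finset.range n, ((L : ℝ) ^ (d - 1)) ^ (K + i)
                * Real.exp (-(δ * (ρ * (L : ℝ) ^ (K + i) / (L : ℝ) ^ K)))) := h
    _ ≤ C₀ * (A₁ * ((L : ℝ) ^ K / ρ) ^ (d - 1) * ρ ^ (-(γ / 2)) + A₂ * ((L : ℝ) ^ K / ρ) ^ (d - 1) * ρ ^ (-(γ / 2))) := by
        refine mul_le_mul_of_nonneg_left (add_le_add ?_ h2') hC₀.le
        rw [hA₁]
        exact h1
    _ = C₀ * (A₁ + A₂) * ((L : ℝ) ^ K / ρ) ^ (d - 1) * ρ ^ (-(γ / 2)) := by ring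

end Summit.QuantumFields.YangMills.BalabanUVNodes.N15KingModelRung.Curved
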